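import Summits.CriticalPhenomena.PercolationContinuityZ3.Theorems.PercNearOneGluingNoHeavyLowerTailHullPortTAPv
import Summits.CriticalPhenomena.PercolationContinuityZ3.Theorems.PercNearOneGluingNoHeavyLowerTailHullPortCSHDefs
import HarnessLib

/-!
# `NoHeavyLowerTail` (stmt-CriticalPhenomena-4575) — conditioned slack hierarchy, level one: world covariances and the `C_Y`-tower

Support file (prover `prim-ineq-prove-5`; `--supports stmt-CriticalPhenomena-4575`); no definitions, named facts or sorries.
prim-hp-8's Lemma U (memo run/shared/lean/prim/prim-hp-8/PROOF-S5-ALL-R.md §3.3) at level `k = 1`, in the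
"same weights, deleted pairs" bookkeeping of `…HullPortTADefs` / `…HullPortCSHDefs`: owner `x`, avoided set `Y`, decoy `d`,
a target `u`, a constant `c`, `Ψ` any function of the open edge cluster of `x`.  With `Θ = (Ψ(C_x) − E[Ψ(C_x) | C_Y]) 1{x ↮ Y}`:
  `E[Θ 1{u ∈ C_x}] − c E[Θ 1{d ∈ C_x}] = E[Θ 1{u ↔ {x,d} ∖ C_Y}] + E[1{d ↮ x,Y} Φ(C_d) (1{u ∈ C_d} − c)]`
is proved in `…HullPortCSHUnfoldOne.lean`; this file has the first half: the world covariance calculus (`covW_add/_smul/_const`),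
the pointwise identity `1{x↔u} − c1{x↔d} = 1{u↔x ∨ u↔d} − 1{d↮x}(1{d↔u} − c) − c` and its world form (`taC_sub_smul_taC_eq`), the
tower property over `C_Y` (`sum_covW_eq_theta`, `Θ ⟂ σ(C_Y)`: `sum_theta_mul_setCl_eq_zero`) and the decoy term as a `Θ`-sum
(`sum_covW_decoy_eq`: the worlds with `d ∈ C_Y` drop out).
[cite: VandenbergHaggstromKahn2005, §2.1 Lemmas 2.3–2.4 (p. 10), §1 pp. 7–8 display (10) — corollaries (conditioning on a cluster)]
-/

noncomputable section

namespace Summit.CriticalPhenomena.PercolationContinuityZ3.Theorems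

open MeasureTheory Set Literature.Probability.LatticeModels Literature.Probability.Percolation
open scoped Classical

variable {V : Type*}

namespace HullPort

open LonePortSum LonePortSumGeneral BHK2006 DecisionTree KNPreFKG

section CSH

variable [Fintype V]

/-! ### Connections in the world `ω ∖ cut_X(ω)` -/

omit [Fintype V] in
/-- A vertex not joined to `X` has the same open edge cluster after deleting the cut set of `X`. [folklore] -/
theorem openEdgeCluster_sdiff_cut_of_avoid (X : Set V) (ω : Set (Sym2 V)) {a : V}
    (ha : ∀ x ∈ X, ¬ (openGraph ω).Reachable x a) :
    openEdgeCluster (ω \ cut X ω) a = openEdgeCluster ω a := by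
  have hT : ∀ t ∈ ({a} : Set V), ¬ (t ∈ X ∨ ∃ e ∈ setCl ω X, t ∈ e) := by
    intro t ht; rw [Set.mem_singleton_iff] at ht; subst ht
    intro h
    obtain ⟨x, hx, hxt⟩ := (setReach_iff ω X t).2 h
    exact ha x hx hxt
  have := setCl_eq_sdiff_barOf (rfl : setCl ω X = setCl ω X) hT
  rw [setCl_singleton, setCl_singleton, ← cut_eq_barOf] at this
  exact this.symm

omit [Fintype V] in
/-- A vertex not joined to `X` has the same connections after deleting the cut set of `X`. [folklore] -/
theorem reachable_sdiff_cut_iff_of_avoid (X : Set V) (ω : Set (Sym2 V)) {a : V}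
    (ha : ∀ x ∈ X, ¬ (openGraph ω).Reachable x a) (b : V) :
    (openGraph (ω \ cut X ω)).Reachable a b ↔ (openGraph ω).Reachable a b := by
  rw [reachable_iff_exists_mem_openEdgeCluster, reachable_iff_exists_mem_openEdgeCluster,
    openEdgeCluster_sdiff_cut_of_avoid X ω ha]

omit [Fintype V] in
/-- A vertex joined to `X` is isolated after deleting the cut set of `X`. [folklore] -/
theorem eq_of_reachable_sdiff_cut (X : Set V) (ω : Set (Sym2 V)) {a : V}
    (ha : ∃ x ∈ X, (openGraph ω).Reachable x a) {b : V} (h : (openGraph (ω \ cut X ω)).Reachable a b) : b = a := by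
  obtain ⟨x, hx, hxa⟩ := ha
  rw [SimpleGraph.reachable_iff_reflTransGen] at h
  induction h with
  | refl => rfl
  | @tail b c _ hbc ih =>
    subst ih
    obtain ⟨⟨_, hnot⟩, _⟩ := (openGraph_adj _ _ c).1 hbc
    exact absurd ⟨_, Sym2.mem_mk_left _ c, x, hx, hxa⟩ hnot

/-! ### Linear algebra of the world covariance -/

/-- `delE` of a constant. [folklore] -/
theorem delE_const (w : Sym2 V → ℝ) (hm : ∑ ω, weight w ω = 1) (B : Set (Sym2 V)) (k : ℝ) :
    delE w B (fun _ => k) = k := by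
  simp only [delE, ← Finset.sum_mul, hm, one_mul]

/-- `covW` is additive in the second functional. [folklore] -/
theorem covW_add (w : Sym2 V → ℝ) (Y : Set V) (A F G : Set (Sym2 V) → ℝ) (ω : Set (Sym2 V)) :
    covW w Y A (fun η => F η + G η) ω = covW w Y A F ω + covW w Y A G ω := by
  simp only [covW]
  have h1 : delE w (cut Y ω) (fun η => A η * (F η + G η)) =
      delE w (cut Y ω) (fun η => A η * F η) + delE w (cut Y ω) (fun η => A η * G η) := by
    simp only [delE, ← Finset.sum_add_distrib]; exact Finset.sum_congr rfl fun η _ => by ring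
  have h2 : delE w (cut Y ω) (fun η => F η + G η) = delE w (cut Y ω) F + delE w (cut Y ω) G := by
    simp only [delE, ← Finset.sum_add_distrib]; exact Finset.sum_congr rfl fun η _ => by ring
  rw [h1, h2]; ring

/-- `covW` is homogeneous in the second functional. [folklore] -/
theorem covW_smul (w : Sym2 V → ℝ) (Y : Set V) (A F : Set (Sym2 V) → ℝ) (k : ℝ) (ω : Set (Sym2 V)) :
    covW w Y A (fun η => k * F η) ω = k * covW w Y A F ω := by
  simp only [covW]
  have h1 : delE w (cut Y ω) (fun η => A η * (k * F η)) = k * delE w (cut Y ω) (fun η => A η * F η) := by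
    simp only [delE, Finset.mul_sum]; exact Finset.sum_congr rfl fun η _ => by ring
  have h2 : delE w (cut Y ω) (fun η => k * F η) = k * delE w (cut Y ω) F := by
    simp only [delE, Finset.mul_sum]; exact Finset.sum_congr rfl fun η _ => by ring
  rw [h1, h2]; ring

/-- `covW` against a constant vanishes. [folklore] -/
theorem covW_const (w : Sym2 V → ℝ) (hm : ∑ ω, weight w ω = 1) (Y : Set V) (A : Set (Sym2 V) → ℝ) (k : ℝ)
    (ω : Set (Sym2 V)) : covW w Y A (fun _ => k) ω = 0 := by
  simp only [covW]
  have h1 : delE w (cut Y ω) (fun η => A η * k) = k * delE w (cut Y ω) A := by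
    simp only [delE, Finset.mul_sum]; exact Finset.sum_congr rfl fun η _ => by ring
  rw [h1, delE_const w hm]; ring

/-- `covW` only depends on the second functional pointwise. [folklore] -/
theorem covW_congr (w : Sym2 V → ℝ) (Y : Set V) (A : Set (Sym2 V) → ℝ) {F G : Set (Sym2 V) → ℝ}
    (h : ∀ η, F η = G η) (ω : Set (Sym2 V)) : covW w Y A F ω = covW w Y A G ω := by
  have : F = G := funext h
  rw [this]

/-- `taC` is the world covariance of `g(C_s)` and `1{s ↔ y}`. [folklore] -/
theorem taC_eq_covW (w : Sym2 V → ℝ) (s y : V) (X : Set V) (g : Set (Sym2 V) → ℝ) (ω : Set (Sym2 V)) :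
    taC w s y X g ω = covW w X (fun η => g (openEdgeCluster η s)) (ind (openConn s y : Set (BondConfig V))) ω := rfl

/-! ### The pointwise identity behind Lemma U (k = 1) -/

omit [Fintype V] in
/-- `1{x ↔ u} − c 1{x ↔ d} = 1{u ↔ x ∨ u ↔ d} − 1{d ↮ x}(1{d ↔ u} − c) − c` in every configuration. [folklore] -/
theorem ind_conn_sub_eq (x d u : V) (c : ℝ) (η : Set (Sym2 V)) :
    ind (openConn x u : Set (BondConfig V)) η - c * ind (openConn x d : Set (BondConfig V)) η =
      ind (openConn x u ∪ openConn d u : Set (BondConfig V)) η -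
        ind (avoidEv d {x}) η * (ind (openConn d u : Set (BondConfig V)) η - c) - c := by
  have hav : η ∈ avoidEv d {x} ↔ ¬ (openGraph η).Reachable d x := by
    simp only [avoidEv, Set.mem_setOf_eq, Set.mem_singleton_iff, forall_eq]
  by_cases hdx : (openGraph η).Reachable x d
  · have h1 : η ∉ avoidEv d {x} := fun h => (hav.1 h) hdx.symm
    rw [ind_of_not_mem h1, ind_of_mem (show η ∈ (openConn x d : Set (BondConfig V)) from hdx)]
    by_cases hxu : (openGraph η).Reachable x u
    · rw [ind_of_mem (show η ∈ (openConn x u : Set (BondConfig V)) from hxu),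
        ind_of_mem (show η ∈ (openConn x u ∪ openConn d u : Set (BondConfig V)) from Or.inl hxu)]
      ring
    · have hdu : ¬ (openGraph η).Reachable d u := fun h => hxu (hdx.trans h)
      rw [ind_of_not_mem (show η ∉ (openConn x u : Set (BondConfig V)) from hxu),
        ind_of_not_mem (show η ∉ (openConn x u ∪ openConn d u : Set (BondConfig V)) from fun h => h.elim hxu hdu)]
      ring
  · have h1 : η ∈ avoidEv d {x} := hav.2 fun h => hdx h.symm
    rw [ind_of_mem h1, ind_of_not_mem (show η ∉ (openConn x d : Set (BondConfig V)) from hdx)]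
    by_cases hxu : (openGraph η).Reachable x u
    · have hdu : ¬ (openGraph η).Reachable d u := fun h => hdx (hxu.trans h.symm)
      rw [ind_of_mem (show η ∈ (openConn x u : Set (BondConfig V)) from hxu),
        ind_of_mem (show η ∈ (openConn x u ∪ openConn d u : Set (BondConfig V)) from Or.inl hxu),
        ind_of_not_mem (show η ∉ (openConn d u : Set (BondConfig V)) from hdu)]
      ring
    · rw [ind_of_not_mem (show η ∉ (openConn x u : Set (BondConfig V)) from hxu)]
      by_cases hdu : (openGraph η).Reachable d u
      · rw [ind_of_mem (show η ∈ (openConn x u ∪ openConn d u : Set (BondConfig V)) from Or.inr hdu),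
          ind_of_mem (show η ∈ (openConn d u : Set (BondConfig V)) from hdu)]
        ring
      · rw [ind_of_not_mem (show η ∉ (openConn x u ∪ openConn d u : Set (BondConfig V)) from fun h => h.elim hxu hdu),
          ind_of_not_mem (show η ∉ (openConn d u : Set (BondConfig V)) from hdu)]
        ring

/-- **World by world**: `taC(u) − c·taC(d) = covW(Ψ(C_x), 1{u ↔ x ∨ u ↔ d}) − covW(Ψ(C_x), 1{d↮x}(1{d↔u} − c))`.
(transcription of the cell memo prim-hp-8 PROOF-S5-ALL-R.md §3.3, the pointwise CLAIM at k = 1) [folklore] -/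
theorem taC_sub_smul_taC_eq (w : Sym2 V → ℝ) (hm : ∑ ω, weight w ω = 1) (x d u : V) (Y : Set V)
    (Ψ : Set (Sym2 V) → ℝ) (c : ℝ) (ω : Set (Sym2 V)) :
    taC w x u Y Ψ ω - c * taC w x d Y Ψ ω =
      covW w Y (fun η => Ψ (openEdgeCluster η x)) (ind (openConn x u ∪ openConn d u : Set (BondConfig V))) ω -
        covW w Y (fun η => Ψ (openEdgeCluster η x))
          (fun η => ind (avoidEv d {x}) η * (ind (openConn d u : Set (BondConfig V)) η - c)) ω := by
  rw [taC_eq_covW, taC_eq_covW, ← covW_smul]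
  have e1 := covW_add w Y (fun η => Ψ (openEdgeCluster η x))
    (fun η => ind (openConn x u : Set (BondConfig V)) η - c * ind (openConn x d : Set (BondConfig V)) η)
    (fun η => c * ind (openConn x d : Set (BondConfig V)) η) ω
  have e2 := covW_add w Y (fun η => Ψ (openEdgeCluster η x))
    (fun η => ind (openConn x u ∪ openConn d u : Set (BondConfig V)) η -
      ind (avoidEv d {x}) η * (ind (openConn d u : Set (BondConfig V)) η - c) - c)
    (fun _ => c) ω
  have e3 := covW_add w Y (fun η => Ψ (openEdgeCluster η x))
    (fun η => ind (openConn x u ∪ openConn d u : Set (BondConfig V)) η -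
      ind (avoidEv d {x}) η * (ind (openConn d u : Set (BondConfig V)) η - c))
    (fun _ => -c) ω
  have e4 := covW_add w Y (fun η => Ψ (openEdgeCluster η x))
    (fun η => ind (openConn x u ∪ openConn d u : Set (BondConfig V)) η)
    (fun η => -(ind (avoidEv d {x}) η * (ind (openConn d u : Set (BondConfig V)) η - c))) ω
  have e5 := covW_smul w Y (fun η => Ψ (openEdgeCluster η x))
    (fun η => ind (avoidEv d {x}) η * (ind (openConn d u : Set (BondConfig V)) η - c)) (-1) ω
  have k1 := covW_const w hm Y (fun η => Ψ (openEdgeCluster η x)) c ω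
  have k2 := covW_const w hm Y (fun η => Ψ (openEdgeCluster η x)) (-c) ω
  have hpt := covW_congr w Y (fun η => Ψ (openEdgeCluster η x))
    (F := fun η => ind (openConn x u : Set (BondConfig V)) η - c * ind (openConn x d : Set (BondConfig V)) η)
    (G := fun η => ind (openConn x u ∪ openConn d u : Set (BondConfig V)) η -
      ind (avoidEv d {x}) η * (ind (openConn d u : Set (BondConfig V)) η - c) - c)
    (fun η => ind_conn_sub_eq x d u c η) ω
  simp only [sub_add_cancel] at e1
  have e1' : covW w Y (fun η => Ψ (openEdgeCluster η x)) (ind (openConn x u : Set (BondConfig V))) ω =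
      covW w Y (fun η => Ψ (openEdgeCluster η x))
        (fun η => ind (openConn x u : Set (BondConfig V)) η - c * ind (openConn x d : Set (BondConfig V)) η) ω +
      covW w Y (fun η => Ψ (openEdgeCluster η x)) (fun η => c * ind (openConn x d : Set (BondConfig V)) η) ω := e1
  rw [e1', hpt]
  have : (fun η => ind (openConn x u ∪ openConn d u : Set (BondConfig V)) η -
      ind (avoidEv d {x}) η * (ind (openConn d u : Set (BondConfig V)) η - c) - c) =
      (fun η => (ind (openConn x u ∪ openConn d u : Set (BondConfig V)) η +
        -(ind (avoidEv d {x}) η * (ind (openConn d u : Set (BondConfig V)) η - c))) + -c) := by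
    funext η; ring
  rw [this, covW_add, covW_add, k2]
  have : (fun η => -(ind (avoidEv d {x}) η * (ind (openConn d u : Set (BondConfig V)) η - c))) =
      (fun η => (-1) * (ind (avoidEv d {x}) η * (ind (openConn d u : Set (BondConfig V)) η - c))) := by
    funext η; ring
  rw [this, covW_smul]
  ring

/-! ### Conditioning on `C_Y`: the world sums as `Θ`-weighted sums -/

omit [Fintype V] in
/-- `1{x ↮ Y}` read off the edge cluster of `Y`. [folklore] -/
theorem ind_avoidEv_eq_ind_setCl (x : V) (Y : Set V) (ω : Set (Sym2 V)) :
    ind (avoidEv x Y) ω = ind {W : Set (Sym2 V) | ¬ (x ∈ Y ∨ ∃ e ∈ W, x ∈ e)} (setCl ω Y) := by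
  by_cases h : (x ∈ Y ∨ ∃ e ∈ setCl ω Y, x ∈ e)
  · obtain ⟨y, hy, hyx⟩ := (setReach_iff ω Y x).2 h
    rw [ind_of_not_mem (show ω ∉ avoidEv x Y from fun hω => hω y hy hyx.symm),
      ind_of_not_mem (show setCl ω Y ∉ {W : Set (Sym2 V) | ¬ (x ∈ Y ∨ ∃ e ∈ W, x ∈ e)} from fun hh => hh h)]
  · rw [ind_of_mem (show ω ∈ avoidEv x Y from fun y hy hxy => h ((setReach_iff ω Y x).1 ⟨y, hy, hxy.symm⟩)),
      ind_of_mem (show setCl ω Y ∈ {W : Set (Sym2 V) | ¬ (x ∈ Y ∨ ∃ e ∈ W, x ∈ e)} from h)]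

/-- **Total covariance over `C_Y`** (tower property): the world covariance of `A` and `M`, averaged over `{x ↮ Y}`, is the
`Θ`-weighted sum of `M` read in the world, `Θ(ω) = 1{x↮Y}(A(ω ∖ cut_Y ω) − E_{G−cut_Y ω} A)`.
[cite: VandenbergHaggstromKahn2005, §2.1 Lemma 2.4 (p. 10) — corollary] -/
theorem sum_covW_eq_theta (w : Sym2 V → ℝ) (hm : ∑ ω, weight w ω = 1) (x : V) (Y : Set V)
    (A M : Set (Sym2 V) → ℝ) :
    ∑ ω, weight w ω * (ind (avoidEv x Y) ω * covW w Y A M ω) =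
      ∑ ω, weight w ω * (ind (avoidEv x Y) ω * ((A (ω \ cut Y ω) - delE w (cut Y ω) A) * M (ω \ cut Y ω))) := by
  set I : Set (Set (Sym2 V)) := {W | ¬ (x ∈ Y ∨ ∃ e ∈ W, x ∈ e)} with hI
  have k1 := set_sum_cond_sdiff w hm Y (fun W ζ => ind I W * (A ζ * M ζ))
  have k2 := set_sum_cond_sdiff w hm Y (fun W ζ => ind I W * (delE w (barOf Y W) A * M ζ))
  have e1 : ∑ ω, weight w ω * (ind (avoidEv x Y) ω * (A (ω \ cut Y ω) * M (ω \ cut Y ω))) =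
      ∑ ω, weight w ω * (ind (avoidEv x Y) ω * delE w (cut Y ω) (fun η => A η * M η)) := by
    calc ∑ ω, weight w ω * (ind (avoidEv x Y) ω * (A (ω \ cut Y ω) * M (ω \ cut Y ω)))
        = ∑ ω, weight w ω * (ind I (setCl ω Y) * (A (ω \ barOf Y (setCl ω Y)) * M (ω \ barOf Y (setCl ω Y)))) :=
          Finset.sum_congr rfl fun ω _ => by rw [ind_avoidEv_eq_ind_setCl, cut_eq_barOf]
      _ = _ := k1
      _ = _ := Finset.sum_congr rfl fun ω _ => by
          rw [ind_avoidEv_eq_ind_setCl, cut_eq_barOf]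
          simp only [delE, Finset.mul_sum]
          exact Finset.sum_congr rfl fun η _ => by ring
  have e2 : ∑ ω, weight w ω * (ind (avoidEv x Y) ω * (delE w (cut Y ω) A * M (ω \ cut Y ω))) =
      ∑ ω, weight w ω * (ind (avoidEv x Y) ω * (delE w (cut Y ω) A * delE w (cut Y ω) M)) := by
    calc ∑ ω, weight w ω * (ind (avoidEv x Y) ω * (delE w (cut Y ω) A * M (ω \ cut Y ω)))
        = ∑ ω, weight w ω * (ind I (setCl ω Y) * (delE w (barOf Y (setCl ω Y)) A * M (ω \ barOf Y (setCl ω Y)))) :=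
          Finset.sum_congr rfl fun ω _ => by rw [ind_avoidEv_eq_ind_setCl, cut_eq_barOf]
      _ = _ := k2
      _ = _ := Finset.sum_congr rfl fun ω _ => by
          rw [ind_avoidEv_eq_ind_setCl, cut_eq_barOf]
          simp only [delE, Finset.mul_sum]
          exact Finset.sum_congr rfl fun η _ => by ring
  have lhs : ∑ ω, weight w ω * (ind (avoidEv x Y) ω * covW w Y A M ω) =
      ∑ ω, weight w ω * (ind (avoidEv x Y) ω * delE w (cut Y ω) (fun η => A η * M η)) -
        ∑ ω, weight w ω * (ind (avoidEv x Y) ω * (delE w (cut Y ω) A * delE w (cut Y ω) M)) := by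
    rw [← Finset.sum_sub_distrib]; refine Finset.sum_congr rfl fun ω _ => ?_; simp only [covW]; ring
  have rhs : ∑ ω, weight w ω * (ind (avoidEv x Y) ω * ((A (ω \ cut Y ω) - delE w (cut Y ω) A) * M (ω \ cut Y ω))) =
      ∑ ω, weight w ω * (ind (avoidEv x Y) ω * (A (ω \ cut Y ω) * M (ω \ cut Y ω))) -
        ∑ ω, weight w ω * (ind (avoidEv x Y) ω * (delE w (cut Y ω) A * M (ω \ cut Y ω))) := by
    rw [← Finset.sum_sub_distrib]; refine Finset.sum_congr rfl fun ω _ => ?_; ring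
  rw [lhs, rhs, e1, e2]

/-- **`Θ` is orthogonal to functions of `C_Y`**: `Σ_ω w Θ(ω) H(C_Y(ω)) = 0`. [cite: VandenbergHaggstromKahn2005, §2.1 Lemma 2.4 (p. 10) — corollary] -/
theorem sum_theta_mul_setCl_eq_zero (w : Sym2 V → ℝ) (hm : ∑ ω, weight w ω = 1) (x : V) (Y : Set V)
    (A : Set (Sym2 V) → ℝ) (H : Set (Sym2 V) → ℝ) :
    ∑ ω, weight w ω * (ind (avoidEv x Y) ω * ((A (ω \ cut Y ω) - delE w (cut Y ω) A) * H (setCl ω Y))) = 0 := by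
  set I : Set (Set (Sym2 V)) := {W | ¬ (x ∈ Y ∨ ∃ e ∈ W, x ∈ e)} with hI
  have k := set_sum_cond_sdiff w hm Y (fun W ζ => ind I W * H W * A ζ)
  have e1 : ∑ ω, weight w ω * (ind (avoidEv x Y) ω * (A (ω \ cut Y ω) * H (setCl ω Y))) =
      ∑ ω, weight w ω * (ind (avoidEv x Y) ω * (delE w (cut Y ω) A * H (setCl ω Y))) := by
    calc ∑ ω, weight w ω * (ind (avoidEv x Y) ω * (A (ω \ cut Y ω) * H (setCl ω Y)))
        = ∑ ω, weight w ω * (ind I (setCl ω Y) * H (setCl ω Y) * A (ω \ barOf Y (setCl ω Y))) :=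
          Finset.sum_congr rfl fun ω _ => by rw [ind_avoidEv_eq_ind_setCl, cut_eq_barOf]; ring
      _ = _ := k
      _ = _ := Finset.sum_congr rfl fun ω _ => by
          rw [ind_avoidEv_eq_ind_setCl, cut_eq_barOf]
          simp only [delE, Finset.mul_sum, Finset.sum_mul]
          exact Finset.sum_congr rfl fun η _ => by ring
  have : ∑ ω, weight w ω * (ind (avoidEv x Y) ω * ((A (ω \ cut Y ω) - delE w (cut Y ω) A) * H (setCl ω Y))) =
      ∑ ω, weight w ω * (ind (avoidEv x Y) ω * (A (ω \ cut Y ω) * H (setCl ω Y))) -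
        ∑ ω, weight w ω * (ind (avoidEv x Y) ω * (delE w (cut Y ω) A * H (setCl ω Y))) := by
    rw [← Finset.sum_sub_distrib]; refine Finset.sum_congr rfl fun ω _ => ?_; ring
  rw [this, e1, sub_self]

omit [Fintype V] in
/-- The decoy factor read in the world `ω ∖ cut_Y(ω)`: for `d ≠ x`, `d ≠ u`,
`1{d↮x}(1{d↔u} − c)` evaluated off `cut_Y` is `1{d↮x,Y}(1{d↔u} − c) − c·1{d ↔ Y}` in `ω`. [folklore] -/
theorem decoyFactor_sdiff_cut (x d u : V) (Y : Set V) (c : ℝ) (hdx : d ≠ x) (hdu : d ≠ u)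
    (ω : Set (Sym2 V)) :
    ind (avoidEv d {x}) (ω \ cut Y ω) * (ind (openConn d u : Set (BondConfig V)) (ω \ cut Y ω) - c) =
      ind (avoidEv d (insert x Y)) ω * (ind (openConn d u : Set (BondConfig V)) ω - c) -
        c * ind {W : Set (Sym2 V) | d ∈ Y ∨ ∃ e ∈ W, d ∈ e} (setCl ω Y) := by
  have hav1 : ∀ ζ : Set (Sym2 V), ζ ∈ avoidEv d {x} ↔ ¬ (openGraph ζ).Reachable d x := fun ζ => by
    simp only [avoidEv, Set.mem_setOf_eq, Set.mem_singleton_iff, forall_eq]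
  by_cases hdY' : ∃ y ∈ Y, (openGraph ω).Reachable y d
  · -- `d ∈ C_Y`: isolated in the world
    have hiso : ∀ b, (openGraph (ω \ cut Y ω)).Reachable d b → b = d := fun b hb => eq_of_reachable_sdiff_cut Y ω hdY' hb
    rw [ind_of_mem (show ω \ cut Y ω ∈ avoidEv d {x} from (hav1 _).2 fun h => hdx (hiso x h).symm),
      ind_of_not_mem (show ω \ cut Y ω ∉ (openConn d u : Set (BondConfig V)) from fun h => hdu (hiso u h).symm),
      ind_of_mem (show setCl ω Y ∈ {W : Set (Sym2 V) | d ∈ Y ∨ ∃ e ∈ W, d ∈ e} from (setReach_iff ω Y d).1 hdY')]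
    obtain ⟨y, hy, hyd⟩ := hdY'
    rw [ind_of_not_mem (show ω ∉ avoidEv d (insert x Y) from fun h => h y (Set.mem_insert_of_mem _ hy) hyd.symm)]
    ring
  · -- `d ∉ C_Y`: the world has the same connections of `d`
    have hda : ∀ y ∈ Y, ¬ (openGraph ω).Reachable y d := fun y hy h => hdY' ⟨y, hy, h⟩
    have hr := reachable_sdiff_cut_iff_of_avoid Y ω hda
    rw [ind_of_not_mem (show setCl ω Y ∉ {W : Set (Sym2 V) | d ∈ Y ∨ ∃ e ∈ W, d ∈ e} from
      fun h => hdY' ((setReach_iff ω Y d).2 h))]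
    have e1 : ind (avoidEv d {x}) (ω \ cut Y ω) = ind (avoidEv d (insert x Y)) ω := by
      by_cases h : (openGraph ω).Reachable d x
      · rw [ind_of_not_mem (show ω \ cut Y ω ∉ avoidEv d {x} from fun hh => (hav1 _).1 hh ((hr x).2 h)),
          ind_of_not_mem (show ω ∉ avoidEv d (insert x Y) from fun hh => hh x (Set.mem_insert _ _) h)]
      · rw [ind_of_mem (show ω \ cut Y ω ∈ avoidEv d {x} from (hav1 _).2 fun hh => h ((hr x).1 hh)),
          ind_of_mem (show ω ∈ avoidEv d (insert x Y) from ?_)]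
        intro t ht
        rcases Set.mem_insert_iff.1 ht with rfl | ht
        · exact h
        · exact fun hdt => hda t ht hdt.symm
    have e2 : ind (openConn d u : Set (BondConfig V)) (ω \ cut Y ω) = ind (openConn d u : Set (BondConfig V)) ω := by
      by_cases h : (openGraph ω).Reachable d u
      · rw [ind_of_mem (show ω \ cut Y ω ∈ (openConn d u : Set (BondConfig V)) from (hr u).2 h),
          ind_of_mem (show ω ∈ (openConn d u : Set (BondConfig V)) from h)]
      · rw [ind_of_not_mem (show ω \ cut Y ω ∉ (openConn d u : Set (BondConfig V)) from fun hh => h ((hr u).1 hh)),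
          ind_of_not_mem (show ω ∉ (openConn d u : Set (BondConfig V)) from h)]
    rw [e1, e2]; ring

/-- **The decoy term as a `Θ`-sum** (k = 1): for `d ≠ x, u`,
`Σ_ω w 1{x↮Y} covW(A, 1{d↮x}(1{d↔u} − c)) = Σ_ω w Θ(ω) · 1{d ↮ x,Y}(1{d ↔ u} − c)`.
(transcription of the cell memo prim-hp-8 PROOF-S5-ALL-R.md §3.3: "the worlds with `d ∈ C_Y` drop out") [folklore] -/
theorem sum_covW_decoy_eq (w : Sym2 V → ℝ) (hm : ∑ ω, weight w ω = 1) (x d u : V) (Y : Set V) (c : ℝ)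
    (hdx : d ≠ x) (hdu : d ≠ u) (A : Set (Sym2 V) → ℝ) :
    ∑ ω, weight w ω * (ind (avoidEv x Y) ω * covW w Y A
        (fun η => ind (avoidEv d {x}) η * (ind (openConn d u : Set (BondConfig V)) η - c)) ω) =
      ∑ ω, weight w ω * (ind (avoidEv x Y) ω * ((A (ω \ cut Y ω) - delE w (cut Y ω) A) *
        (ind (avoidEv d (insert x Y)) ω * (ind (openConn d u : Set (BondConfig V)) ω - c)))) := by
  rw [sum_covW_eq_theta w hm]
  have h0 := sum_theta_mul_setCl_eq_zero w hm x Y A (fun W => c * ind {W : Set (Sym2 V) | d ∈ Y ∨ ∃ e ∈ W, d ∈ e} W)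
  have : ∑ ω, weight w ω * (ind (avoidEv x Y) ω * ((A (ω \ cut Y ω) - delE w (cut Y ω) A) *
      (ind (avoidEv d {x}) (ω \ cut Y ω) * (ind (openConn d u : Set (BondConfig V)) (ω \ cut Y ω) - c)))) =
      ∑ ω, weight w ω * (ind (avoidEv x Y) ω * ((A (ω \ cut Y ω) - delE w (cut Y ω) A) *
        (ind (avoidEv d (insert x Y)) ω * (ind (openConn d u : Set (BondConfig V)) ω - c)))) -
      ∑ ω, weight w ω * (ind (avoidEv x Y) ω * ((A (ω \ cut Y ω) - delE w (cut Y ω) A) *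
        (c * ind {W : Set (Sym2 V) | d ∈ Y ∨ ∃ e ∈ W, d ∈ e} (setCl ω Y)))) := by
    rw [← Finset.sum_sub_distrib]
    refine Finset.sum_congr rfl fun ω _ => ?_
    rw [decoyFactor_sdiff_cut x d u Y c hdx hdu ω]; ring
  rw [this, h0, sub_zero]

end CSH

end HullPort

end Summit.CriticalPhenomena.PercolationContinuityZ3.Theorems
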